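import Literature.Analysis.OperatorTheory.TempleCertificate
import HarnessLib

/-!
# Eigenvectors span from a multiplicity obstruction (Kato, *Perturbation theory*, §I.5)

Topic `Analysis/OperatorTheory`; theorems only.  For a linear map `T` on a real inner product space and a real
number `l`: if NO orthonormal pair (resp. triple) of `l`-eigenvectors exists, then every `l`-eigenvector is a multiple
of a given unit `l`-eigenvector (resp. lies in the span of a given orthonormal pair of them).  This is how certified
eigenvalue enclosures (`TempleCertificate.lean`: an orthonormal `m`-family of bottom eigenvectors forces `m ρhi² ≤ h`)
pin down the bottom eigenspace exactly. [folklore]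

## References
* T. Kato, *Perturbation Theory for Linear Operators* (1966), §I.5 [Kato1966].
-/

noncomputable section

namespace Literature.Analysis.OperatorTheory

/-- **The bottom eigenspace is a line**: if no orthonormal PAIR of `l`-eigenvectors exists, every `l`-eigenvector is a
multiple of a given unit one. [folklore] -/
theorem eq_smul_of_no_orthonormal_pair {V : Type*} [NormedAddCommGroup V] [InnerProductSpace ℝ V] (T : V →L[ℝ] V) (l : ℝ)
    {w : V} (hw : ‖w‖ = 1) (hTw : T w = l • w)
    (hno : ∀ f : Fin 2 → V, Orthonormal ℝ f → (∀ j, T (f j) = l • f j) → False)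
    {v : V} (hv : T v = l • v) : v = (inner ℝ w v) • w := by
  by_contra hne
  set v' : V := v - (inner ℝ w v) • w with hv'
  have hv'0 : v' ≠ 0 := fun h0 => hne (sub_eq_zero.1 h0)
  have hTv' : T v' = l • v' := by rw [hv', map_sub, map_smul, hv, hTw, smul_sub, smul_comm]
  have horth : inner ℝ w v' = 0 := by
    rw [hv', inner_sub_right, real_inner_smul_right, real_inner_self_eq_norm_sq, hw]; ring
  have hn : ‖v'‖ ≠ 0 := norm_ne_zero_iff.2 hv'0
  refine hno ![w, (‖v'‖⁻¹ : ℝ) • v'] ?_ ?_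
  · rw [orthonormal_iff_ite]
    intro i j
    fin_cases i <;> fin_cases j
    · simp only [Fin.zero_eta, Fin.isValue, Matrix.cons_val_zero, ↓reduceIte]
      rw [real_inner_self_eq_norm_sq, hw]; norm_num
    · simp only [Fin.zero_eta, Fin.isValue, Matrix.cons_val_zero, Fin.mk_one, Matrix.cons_val_one,
        Matrix.cons_val_fin_one, zero_ne_one, ↓reduceIte]
      rw [real_inner_smul_right, horth, mul_zero]
    · simp only [Fin.mk_one, Fin.isValue, Matrix.cons_val_one, Matrix.cons_val_fin_one, Fin.zero_eta,
        Matrix.cons_val_zero, one_ne_zero, ↓reduceIte]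
      rw [real_inner_smul_left, real_inner_comm, horth, mul_zero]
    · simp only [Fin.mk_one, Fin.isValue, Matrix.cons_val_one, Matrix.cons_val_fin_one, ↓reduceIte]
      rw [real_inner_smul_left, real_inner_smul_right, real_inner_self_eq_norm_sq]
      field_simp
  · intro j
    fin_cases j
    · exact hTw
    · simp only [Fin.mk_one, Fin.isValue, Matrix.cons_val_one, Matrix.cons_val_fin_one, map_smul, hTv']
      rw [smul_comm]

/-- **The bottom eigenspace is a plane**: if no orthonormal TRIPLE of `l`-eigenvectors exists, every `l`-eigenvector lies in
the span of a given orthonormal pair of them. [folklore] -/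
theorem eq_add_smul_of_no_orthonormal_triple {V : Type*} [NormedAddCommGroup V] [InnerProductSpace ℝ V] (T : V →L[ℝ] V) (l : ℝ)
    {w₁ w₂ : V} (hw₁ : ‖w₁‖ = 1) (hw₂ : ‖w₂‖ = 1) (h12 : inner ℝ w₁ w₂ = 0)
    (hTw₁ : T w₁ = l • w₁) (hTw₂ : T w₂ = l • w₂)
    (hno : ∀ f : Fin 3 → V, Orthonormal ℝ f → (∀ j, T (f j) = l • f j) → False)
    {v : V} (hv : T v = l • v) : v = (inner ℝ w₁ v) • w₁ + (inner ℝ w₂ v) • w₂ := by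
  by_contra hne
  set v' : V := v - ((inner ℝ w₁ v) • w₁ + (inner ℝ w₂ v) • w₂) with hv'
  have hv'0 : v' ≠ 0 := fun h0 => hne (sub_eq_zero.1 h0)
  have hTv' : T v' = l • v' := by
    rw [hv', map_sub, map_add, map_smul, map_smul, hv, hTw₁, hTw₂, smul_sub, smul_add, smul_comm l (inner ℝ w₁ v),
      smul_comm l (inner ℝ w₂ v)]
  have h21 : inner ℝ w₂ w₁ = 0 := by rw [real_inner_comm]; exact h12
  have horth₁ : inner ℝ w₁ v' = 0 := by
    rw [hv', inner_sub_right, inner_add_right, real_inner_smul_right, real_inner_smul_right,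
      real_inner_self_eq_norm_sq, hw₁, h12]; ring
  have horth₂ : inner ℝ w₂ v' = 0 := by
    rw [hv', inner_sub_right, inner_add_right, real_inner_smul_right, real_inner_smul_right,
      real_inner_self_eq_norm_sq, hw₂, h21]; ring
  have hn : ‖v'‖ ≠ 0 := norm_ne_zero_iff.2 hv'0
  have hpair : Orthonormal ℝ ![w₁, w₂] := by
    rw [orthonormal_iff_ite]
    intro i j
    fin_cases i <;> fin_cases j
    · simp only [Fin.zero_eta, Fin.isValue, Matrix.cons_val_zero, ↓reduceIte]
      rw [real_inner_self_eq_norm_sq, hw₁]; norm_num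
    · simp only [Fin.zero_eta, Fin.isValue, Matrix.cons_val_zero, Fin.mk_one, Matrix.cons_val_one,
        Matrix.cons_val_fin_one, zero_ne_one, ↓reduceIte]
      exact h12
    · simp only [Fin.mk_one, Fin.isValue, Matrix.cons_val_one, Matrix.cons_val_fin_one, Fin.zero_eta,
        Matrix.cons_val_zero, one_ne_zero, ↓reduceIte]
      exact h21
    · simp only [Fin.mk_one, Fin.isValue, Matrix.cons_val_one, Matrix.cons_val_fin_one, ↓reduceIte]
      rw [real_inner_self_eq_norm_sq, hw₂]; norm_num
  have hu : ‖(‖v'‖⁻¹ : ℝ) • v'‖ = 1 := by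
    rw [norm_smul, Real.norm_eq_abs, abs_of_pos (inv_pos.2 ((norm_nonneg _).lt_of_ne hn.symm)), inv_mul_cancel₀ hn]
  have htriple := orthonormal_fin_cons (𝕜 := ℝ) (u := (‖v'‖⁻¹ : ℝ) • v') (w := ![w₁, w₂]) hu hpair (by
    intro j
    fin_cases j
    · simp only [Fin.zero_eta, Fin.isValue, Matrix.cons_val_zero, real_inner_smul_right, horth₁, mul_zero]
    · simp only [Fin.mk_one, Fin.isValue, Matrix.cons_val_one, Matrix.cons_val_fin_one, real_inner_smul_right,
        horth₂, mul_zero])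
  refine hno _ htriple ?_
  intro j
  refine Fin.cases ?_ (fun j => ?_) j
  · simp only [Fin.cons_zero, map_smul, hTv']
    rw [smul_comm]
  · fin_cases j
    · simpa using hTw₁
    · simpa using hTw₂


end Literature.Analysis.OperatorTheory

end
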